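import Mathlib

/-!
# The Fejér-type kernels `(1 − cos ω)/ω²` and `(1 − cos v)/(v√v)` on `(0,∞)`: integrability, scaling, and the
# spectral representation of `min`

Real-analysis lemmas for the spectral form of the bath-heat transient (crux `stmt-AtomisticToContinuum-9120`, line
`bath-bond-deficit-integral`, lead c5):

* `integrableOn_one_sub_cos_div_sq`, `integral_one_sub_cos_div_sq_pos` — `c₁ := ∫_{(0,∞)} (1 − cos ω)/ω² dω ∈ (0,∞)`
  (no closed form is used; `c₁ = π/2`);
* `integral_one_sub_cos_mul_div_sq` — scaling: `∫_{(0,∞)} (1 − cos(ωa))/ω² dω = a·c₁` for `a ≥ 0`;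
* `integral_one_sub_cos_mul_one_sub_cos_div_sq` — **spectral representation of `min`**: for `u, t ≥ 0`,
  `∫_{(0,∞)} (1 − cos ωt)(1 − cos ωu)/ω² dω = c₁·min u t`
  (from `(1−cos ωt)(1−cos ωu) = (1−cos ωt) + (1−cos ωu) − ½(1−cos ω(t−u)) − ½(1−cos ω(t+u))`);
* `integrableOn_one_sub_cos_div_mul_sqrt`, `integral_one_sub_cos_mul_div_mul_sqrt` — `c₂ := ∫_{(0,∞)} (1 − cos v)/(v√v) dv < ∞`
  and the scaling `∫_{(0,∞)} (1 − cos ωt)/(ω√ω) dω = c₂√t` (`t > 0`), the `√t` of the Edwards–Wilkinson law;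
* `integral_Ioi_one_div_sq` — `∫_{(1,∞)} ω⁻² dω = 1`.
-/

noncomputable section

open MeasureTheory Set Filter Topology

namespace Summit.AtomisticToContinuum.FouriersLaw.Theorems.SubdiffusiveBondHeat

/-! ### Pointwise bounds -/

/-- `0 ≤ (1 − cos x)/x²`. [folklore] -/
theorem one_sub_cos_div_sq_nonneg (x : ℝ) : 0 ≤ (1 - Real.cos x) / x ^ 2 :=
  div_nonneg (sub_nonneg.2 (Real.cos_le_one x)) (sq_nonneg x)

/-- `(1 − cos x)/x² ≤ 1/2` (from `1 − x²/2 ≤ cos x`). [folklore] -/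
theorem one_sub_cos_div_sq_le_half (x : ℝ) : (1 - Real.cos x) / x ^ 2 ≤ 1 / 2 := by
  rcases eq_or_ne x 0 with rfl | hx
  · simp
  · rw [div_le_iff₀ (by positivity)]
    have := Real.one_sub_sq_div_two_le_cos (x := x)
    linarith

/-- `(1 − cos x)/x² ≤ 2/x²`. [folklore] -/
theorem one_sub_cos_div_sq_le_two_div_sq (x : ℝ) : (1 - Real.cos x) / x ^ 2 ≤ 2 / x ^ 2 := by
  rcases eq_or_ne x 0 with rfl | hx
  · simp
  · exact div_le_div_of_nonneg_right (by linarith [Real.neg_one_le_cos x]) (sq_nonneg x)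

/-- `0 ≤ 1 − cos x ≤ 2`. [folklore] -/
theorem one_sub_cos_mem_Icc (x : ℝ) : 1 - Real.cos x ∈ Icc (0 : ℝ) 2 :=
  ⟨sub_nonneg.2 (Real.cos_le_one x), by linarith [Real.neg_one_le_cos x]⟩

/-! ### `c₁ = ∫_{(0,∞)} (1 − cos ω)/ω²` -/

/-- Measurability of `ω ↦ (1 − cos(ωa))/ω²`. [folklore] -/
theorem measurable_one_sub_cos_mul_div_sq (a : ℝ) : Measurable fun ω : ℝ => (1 - Real.cos (ω * a)) / ω ^ 2 := by
  fun_prop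

/-- `(1 − cos ω)/ω²` is integrable on `(1,∞)` (dominated by `2ω⁻²`). [folklore] -/
theorem integrableOn_one_sub_cos_div_sq_Ioi_one : IntegrableOn (fun ω : ℝ => (1 - Real.cos ω) / ω ^ 2) (Ioi 1) := by
  have h2 : IntegrableOn (fun ω : ℝ => 2 * ω ^ (-2 : ℝ)) (Ioi 1) :=
    (integrableOn_Ioi_rpow_of_lt (by norm_num) one_pos).const_mul 2
  have hm : Measurable fun ω : ℝ => (1 - Real.cos ω) / ω ^ 2 := by fun_prop
  refine h2.mono' hm.aestronglyMeasurable ?_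
  refine (ae_restrict_iff' measurableSet_Ioi).2 (Eventually.of_forall fun ω hω => ?_)
  have hω0 : 0 < ω := lt_trans one_pos hω
  rw [Real.norm_eq_abs, abs_of_nonneg (one_sub_cos_div_sq_nonneg ω)]
  calc (1 - Real.cos ω) / ω ^ 2 ≤ 2 / ω ^ 2 := one_sub_cos_div_sq_le_two_div_sq ω
    _ = 2 * ω ^ (-2 : ℝ) := by
        rw [Real.rpow_neg hω0.le, div_eq_mul_inv]
        norm_num

/-- `(1 − cos ω)/ω²` is integrable on `(0,∞)` (bounded by `1/2` on `(0,1]`, by `2ω⁻²` beyond). [folklore] -/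
theorem integrableOn_one_sub_cos_div_sq : IntegrableOn (fun ω : ℝ => (1 - Real.cos ω) / ω ^ 2) (Ioi 0) := by
  rw [← Ioc_union_Ioi_eq_Ioi zero_le_one]
  refine IntegrableOn.union ?_ integrableOn_one_sub_cos_div_sq_Ioi_one
  have hm : Measurable fun ω : ℝ => (1 - Real.cos ω) / ω ^ 2 := by fun_prop
  refine (integrableOn_const (C := (1 / 2 : ℝ)) (by simp)).mono' hm.aestronglyMeasurable ?_
  refine Eventually.of_forall fun ω => ?_
  rw [Real.norm_eq_abs, abs_of_nonneg (one_sub_cos_div_sq_nonneg ω)]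
  exact one_sub_cos_div_sq_le_half ω

/-- **`c₁ > 0`**: on `[π/2, π] ⊂ (0,∞)` the integrand is `≥ 1/π²` (`cos ≤ 0` there). [folklore] -/
theorem integral_one_sub_cos_div_sq_pos : 0 < ∫ ω in Ioi (0 : ℝ), (1 - Real.cos ω) / ω ^ 2 := by
  have hsub : Icc (Real.pi / 2) Real.pi ⊆ Ioi (0 : ℝ) := fun ω hω => lt_of_lt_of_le (by positivity) hω.1
  have h1 : ∫ ω in Icc (Real.pi / 2) Real.pi, (1 - Real.cos ω) / ω ^ 2 ≤ ∫ ω in Ioi (0 : ℝ), (1 - Real.cos ω) / ω ^ 2 :=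
    setIntegral_mono_set integrableOn_one_sub_cos_div_sq
      (Eventually.of_forall fun ω => one_sub_cos_div_sq_nonneg ω) (Eventually.of_forall hsub)
  have h2 : 1 / Real.pi ^ 2 * (volume : Measure ℝ).real (Icc (Real.pi / 2) Real.pi) ≤
      ∫ ω in Icc (Real.pi / 2) Real.pi, (1 - Real.cos ω) / ω ^ 2 := by
    refine setIntegral_ge_of_const_le_real measurableSet_Icc (by simp) (fun ω hω => ?_)
      (integrableOn_one_sub_cos_div_sq.mono_set hsub)
    have hω0 : 0 < ω := lt_of_lt_of_le (by positivity) hω.1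
    have hcos : Real.cos ω ≤ 0 :=
      Real.cos_nonpos_of_pi_div_two_le_of_le hω.1 (by linarith [hω.2, Real.pi_pos])
    rw [div_le_div_iff₀ (by positivity) (by positivity)]
    have hωπ : ω ^ 2 ≤ Real.pi ^ 2 := by
      have := hω.2
      nlinarith
    nlinarith
  have h3 : 0 < 1 / Real.pi ^ 2 * (volume : Measure ℝ).real (Icc (Real.pi / 2) Real.pi) := by
    rw [Real.volume_real_Icc_of_le (by linarith [Real.pi_pos])]
    have : 0 < Real.pi - Real.pi / 2 := by linarith [Real.pi_pos]
    positivity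
  linarith

/-- **Scaling**: `∫_{(0,∞)} (1 − cos(ωa))/ω² dω = a · c₁` for `a ≥ 0`. [folklore] -/
theorem integral_one_sub_cos_mul_div_sq {a : ℝ} (ha : 0 ≤ a) :
    ∫ ω in Ioi (0 : ℝ), (1 - Real.cos (ω * a)) / ω ^ 2 = a * ∫ ω in Ioi (0 : ℝ), (1 - Real.cos ω) / ω ^ 2 := by
  rcases ha.eq_or_lt with rfl | ha'
  · simp
  · have h := integral_comp_mul_right_Ioi (fun x : ℝ => (1 - Real.cos x) / x ^ 2) 0 ha'
    simp only [zero_mul] at h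
    have heq : ∀ ω ∈ Ioi (0 : ℝ), (1 - Real.cos (ω * a)) / ω ^ 2 = a ^ 2 * ((1 - Real.cos (ω * a)) / (ω * a) ^ 2) := by
      intro ω hω
      have hω : (ω : ℝ) ≠ 0 := ne_of_gt hω
      field_simp
    rw [setIntegral_congr_fun measurableSet_Ioi heq, integral_const_mul, h, smul_eq_mul]
    field_simp

/-- Integrability of the scaled kernel `(1 − cos(ωa))/ω²` on `(0,∞)` for `a ≥ 0`. [folklore] -/
theorem integrableOn_one_sub_cos_mul_div_sq {a : ℝ} (ha : 0 ≤ a) :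
    IntegrableOn (fun ω : ℝ => (1 - Real.cos (ω * a)) / ω ^ 2) (Ioi 0) := by
  rcases ha.eq_or_lt with rfl | ha'
  · simp
  · have h := (integrableOn_Ioi_comp_mul_right_iff (fun x : ℝ => (1 - Real.cos x) / x ^ 2) 0 ha').2
      (by simpa using integrableOn_one_sub_cos_div_sq)
    have h' : IntegrableOn (fun ω : ℝ => a ^ 2 * ((1 - Real.cos (ω * a)) / (ω * a) ^ 2)) (Ioi 0) := h.const_mul _
    refine h'.congr_fun (fun ω hω => ?_) measurableSet_Ioi
    have hω : (ω : ℝ) ≠ 0 := ne_of_gt hω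
    field_simp

/-- **Spectral representation of `min`**: for `u, t ≥ 0`,
`∫_{(0,∞)} (1 − cos ωt)(1 − cos ωu)/ω² dω = c₁ · min u t`. [folklore] -/
theorem integral_one_sub_cos_mul_one_sub_cos_div_sq {u t : ℝ} (hu : 0 ≤ u) (ht : 0 ≤ t) :
    ∫ ω in Ioi (0 : ℝ), (1 - Real.cos (ω * t)) * (1 - Real.cos (ω * u)) / ω ^ 2 =
      min u t * ∫ ω in Ioi (0 : ℝ), (1 - Real.cos ω) / ω ^ 2 := by
  set c₁ : ℝ := ∫ ω in Ioi (0 : ℝ), (1 - Real.cos ω) / ω ^ 2 with hc₁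
  -- the four pieces
  have hI := fun {a : ℝ} (ha : 0 ≤ a) => integrableOn_one_sub_cos_mul_div_sq ha
  have hV := fun {a : ℝ} (ha : 0 ≤ a) => integral_one_sub_cos_mul_div_sq ha
  have habs : 0 ≤ |t - u| := abs_nonneg _
  have hsum : 0 ≤ t + u := add_nonneg ht hu
  -- pointwise product-to-sum identity
  have hpt : ∀ ω : ℝ, (1 - Real.cos (ω * t)) * (1 - Real.cos (ω * u)) / ω ^ 2 =
      (1 - Real.cos (ω * t)) / ω ^ 2 + (1 - Real.cos (ω * u)) / ω ^ 2 -
        (1 / 2) * ((1 - Real.cos (ω * |t - u|)) / ω ^ 2) - (1 / 2) * ((1 - Real.cos (ω * (t + u))) / ω ^ 2) := by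
    intro ω
    have h1 : Real.cos (ω * |t - u|) = Real.cos (ω * t - ω * u) := by
      rcases le_total u t with h | h
      · rw [abs_of_nonneg (sub_nonneg.2 h), mul_sub]
      · rw [abs_of_nonpos (sub_nonpos.2 h), neg_sub, mul_sub, ← Real.cos_neg]
        congr 1; ring
    rw [h1, mul_add, Real.cos_sub, Real.cos_add]
    field_simp
    ring
  simp_rw [hpt]
  rw [integral_sub, integral_sub, integral_add (hI ht) (hI hu), integral_const_mul, integral_const_mul,
    hV ht, hV hu, hV habs, hV hsum]
  · -- arithmetic: `t + u − |t−u|/2 − (t+u)/2 = min u t`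
    rcases le_total u t with h | h
    · rw [min_eq_left h, abs_of_nonneg (sub_nonneg.2 h)]; ring
    · rw [min_eq_right h, abs_of_nonpos (sub_nonpos.2 h)]; ring
  · exact (hI ht).add (hI hu)
  · exact (hI habs).const_mul _
  · exact ((hI ht).add (hI hu)).sub ((hI habs).const_mul _)
  · exact (hI hsum).const_mul _

/-- The product kernel is nonnegative and integrable on `(0,∞)` (`u, t ≥ 0`), with the bound
`(1 − cos ωt)(1 − cos ωu)/ω² ≤ 2(1 − cos ωt)/ω²`. [folklore] -/
theorem integrableOn_one_sub_cos_mul_one_sub_cos_div_sq {u t : ℝ} (ht : 0 ≤ t) (u_ : 0 ≤ u) :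
    IntegrableOn (fun ω : ℝ => (1 - Real.cos (ω * t)) * (1 - Real.cos (ω * u)) / ω ^ 2) (Ioi 0) := by
  have _ := u_
  have hm : Measurable fun ω : ℝ => (1 - Real.cos (ω * t)) * (1 - Real.cos (ω * u)) / ω ^ 2 := by fun_prop
  refine ((integrableOn_one_sub_cos_mul_div_sq ht).const_mul 2).mono' hm.aestronglyMeasurable
    (Eventually.of_forall fun ω => ?_)
  have h1 := one_sub_cos_mem_Icc (ω * t)
  have h2 := one_sub_cos_mem_Icc (ω * u)
  rw [Real.norm_eq_abs, abs_of_nonneg (div_nonneg (mul_nonneg h1.1 h2.1) (sq_nonneg ω)), mul_div_assoc']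
  refine div_le_div_of_nonneg_right ?_ (sq_nonneg ω)
  nlinarith [h1.1, h1.2, h2.1, h2.2]

/-! ### `c₂ = ∫_{(0,∞)} (1 − cos v)/(v√v)` and the `√t` scaling -/

/-- `(1 − cos v)/(v√v)` is integrable on `(0,∞)` (bounded by `1/2` on `(0,1]`, by `2v^{−3/2}` beyond). [folklore] -/
theorem integrableOn_one_sub_cos_div_mul_sqrt :
    IntegrableOn (fun v : ℝ => (1 - Real.cos v) / (v * Real.sqrt v)) (Ioi 0) := by
  have hm : Measurable fun v : ℝ => (1 - Real.cos v) / (v * Real.sqrt v) := by fun_prop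
  rw [← Ioc_union_Ioi_eq_Ioi zero_le_one]
  refine IntegrableOn.union ?_ ?_
  · refine (integrableOn_const (C := (1 / 2 : ℝ)) (by simp)).mono' hm.aestronglyMeasurable ?_
    refine (ae_restrict_iff' measurableSet_Ioc).2 (Eventually.of_forall fun v hv => ?_)
    have hv0 : 0 < v := hv.1
    have hsq : 0 < Real.sqrt v := Real.sqrt_pos.2 hv0
    have hsq1 : Real.sqrt v ≤ 1 := by
      rw [← Real.sqrt_one]; exact Real.sqrt_le_sqrt hv.2
    rw [Real.norm_eq_abs, abs_of_nonneg (div_nonneg (one_sub_cos_mem_Icc v).1 (by positivity)),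
      div_le_iff₀ (by positivity)]
    have h1 : 1 - Real.cos v ≤ v ^ 2 / 2 := by
      have := Real.one_sub_sq_div_two_le_cos (x := v)
      linarith
    have hvv : v ^ 2 = Real.sqrt v * Real.sqrt v * v := by
      rw [Real.mul_self_sqrt hv0.le]; ring
    nlinarith [hsq.le, hv.2, Real.mul_self_sqrt hv0.le]
  · have h2 : IntegrableOn (fun v : ℝ => 2 * v ^ (-(3 / 2) : ℝ)) (Ioi 1) :=
      (integrableOn_Ioi_rpow_of_lt (by norm_num) one_pos).const_mul 2
    refine h2.mono' hm.aestronglyMeasurable ?_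
    refine (ae_restrict_iff' measurableSet_Ioi).2 (Eventually.of_forall fun v hv => ?_)
    have hv0 : 0 < v := lt_trans one_pos hv
    have hpow : v * Real.sqrt v = v ^ ((3 / 2) : ℝ) := by
      rw [Real.sqrt_eq_rpow, ← Real.rpow_one_add' hv0.le (by norm_num)]
      norm_num
    rw [Real.norm_eq_abs, abs_of_nonneg (div_nonneg (one_sub_cos_mem_Icc v).1 (by positivity)), hpow,
      Real.rpow_neg hv0.le, div_eq_mul_inv]
    exact mul_le_mul_of_nonneg_right (one_sub_cos_mem_Icc v).2 (inv_nonneg.2 (Real.rpow_nonneg hv0.le _))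

/-- `0 ≤ c₂`. [folklore] -/
theorem integral_one_sub_cos_div_mul_sqrt_nonneg : 0 ≤ ∫ v in Ioi (0 : ℝ), (1 - Real.cos v) / (v * Real.sqrt v) :=
  setIntegral_nonneg measurableSet_Ioi fun v hv =>
    div_nonneg (one_sub_cos_mem_Icc v).1 (mul_nonneg (le_of_lt hv) (Real.sqrt_nonneg v))

/-- **`√t` scaling**: `∫_{(0,∞)} (1 − cos ωt)/(ω√ω) dω = c₂·√t` for `t > 0`. [folklore] -/
theorem integral_one_sub_cos_mul_div_mul_sqrt {t : ℝ} (ht : 0 < t) :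
    ∫ ω in Ioi (0 : ℝ), (1 - Real.cos (ω * t)) / (ω * Real.sqrt ω) =
      Real.sqrt t * ∫ v in Ioi (0 : ℝ), (1 - Real.cos v) / (v * Real.sqrt v) := by
  have h := integral_comp_mul_right_Ioi (fun v : ℝ => (1 - Real.cos v) / (v * Real.sqrt v)) 0 ht
  simp only [zero_mul] at h
  have hst : 0 < Real.sqrt t := Real.sqrt_pos.2 ht
  have heq : ∀ ω ∈ Ioi (0 : ℝ), (1 - Real.cos (ω * t)) / (ω * Real.sqrt ω) =
      t * Real.sqrt t * ((1 - Real.cos (ω * t)) / (ω * t * Real.sqrt (ω * t))) := by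
    intro ω hω
    have hω : (0 : ℝ) < ω := hω
    have hsω : 0 < Real.sqrt ω := Real.sqrt_pos.2 hω
    rw [Real.sqrt_mul hω.le]
    field_simp
  rw [setIntegral_congr_fun measurableSet_Ioi heq, integral_const_mul, h, smul_eq_mul, ← mul_assoc]
  congr 1
  field_simp

/-- Integrability of `(1 − cos ωt)/(ω√ω)` on `(0,∞)` for `t > 0`. [folklore] -/
theorem integrableOn_one_sub_cos_mul_div_mul_sqrt {t : ℝ} (ht : 0 < t) :
    IntegrableOn (fun ω : ℝ => (1 - Real.cos (ω * t)) / (ω * Real.sqrt ω)) (Ioi 0) := by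
  have h := (integrableOn_Ioi_comp_mul_right_iff (fun v : ℝ => (1 - Real.cos v) / (v * Real.sqrt v)) 0 ht).2
    (by simpa using integrableOn_one_sub_cos_div_mul_sqrt)
  have h' : IntegrableOn (fun ω : ℝ => t * Real.sqrt t * ((1 - Real.cos (ω * t)) / (ω * t * Real.sqrt (ω * t))))
      (Ioi 0) := h.const_mul _
  refine h'.congr_fun (fun ω hω => ?_) measurableSet_Ioi
  have hω : (0 : ℝ) < ω := hω
  have hsω : 0 < Real.sqrt ω := Real.sqrt_pos.2 hω
  have hst : 0 < Real.sqrt t := Real.sqrt_pos.2 ht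
  dsimp only
  rw [Real.sqrt_mul hω.le]
  field_simp

/-! ### `∫_{(1,∞)} ω⁻² dω = 1` -/

/-- `∫_{(1,∞)} ω⁻² dω = 1`. [folklore] -/
theorem integral_Ioi_one_div_sq : ∫ ω in Ioi (1 : ℝ), 1 / ω ^ 2 = 1 := by
  have h := integral_Ioi_rpow_of_lt (a := -2) (by norm_num) one_pos
  have heq : ∀ ω ∈ Ioi (1 : ℝ), 1 / ω ^ 2 = ω ^ (-2 : ℝ) := by
    intro ω hω
    have hω0 : 0 < ω := lt_trans one_pos hω
    rw [Real.rpow_neg hω0.le, one_div]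
    norm_num
  rw [setIntegral_congr_fun measurableSet_Ioi heq, h]
  norm_num

/-- `ω⁻²` is integrable on `(1,∞)`. [folklore] -/
theorem integrableOn_Ioi_one_div_sq : IntegrableOn (fun ω : ℝ => 1 / ω ^ 2) (Ioi 1) := by
  refine (integrableOn_Ioi_rpow_of_lt (a := -2) (by norm_num) one_pos).congr_fun (fun ω hω => ?_) measurableSet_Ioi
  have hω0 : 0 < ω := lt_trans one_pos hω
  dsimp only
  rw [Real.rpow_neg hω0.le, one_div]
  norm_num

/-- **Spectral representation of `min`, `∀`-form** (registered sub-goal): for `u, t ≥ 0`,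
`∫_{(0,∞)} (1 − cos ωt)(1 − cos ωu)/ω² dω = min u t · ∫_{(0,∞)} (1 − cos ω)/ω² dω`. [folklore] -/
theorem integral_oneSubCos_mul_oneSubCos_div_sq_eq_min :
    ∀ u t : ℝ, 0 ≤ u → 0 ≤ t → ∫ ω in Set.Ioi (0 : ℝ), (1 - Real.cos (ω * t)) * (1 - Real.cos (ω * u)) / ω ^ 2 = min u t * ∫ ω in Set.Ioi (0 : ℝ), (1 - Real.cos ω) / ω ^ 2 :=
  fun _ _ hu ht => integral_one_sub_cos_mul_one_sub_cos_div_sq hu ht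

end Summit.AtomisticToContinuum.FouriersLaw.Theorems.SubdiffusiveBondHeat

end
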